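import Summits.CriticalPhenomena.PercolationContinuityZ3.Theorems.PercNearOneGluingNoHeavyLowerTailSahiCTCLumpedForms
import Summits.CriticalPhenomena.PercolationContinuityZ3.Theorems.PercNearOneGluingNoHeavyLowerTailSahiCTCVertexAtoms
import HarnessLib

/-!
# `NoHeavyLowerTail` (crux stmt-CriticalPhenomena-4575), P3 lane: the VERTEX EXPANSION of the lumped R form and C2 ⇒ C1 —
# `[R_D]_1 − [R_D]_0 = ([R_D]_2 − [R_D]_3) + GF(D⁰∖D¹)·GF(X¹∖X⁰)·GF(Z¹∖Z⁰)` (memo g27 §4.3 for every lumped family), hence `R_D ∈ ℕ[s]` from C2 alone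
# for down-sets `D` and up-sets `𝒳, 𝒵`

Support file (seat `prim-l12-p3`, gen 28; `--supports stmt-CriticalPhenomena-4575`).  Memos `…/FROM-prim-l12-p3-g27-RT-MONOTONICITY.md` §4.1–4.3 and
`…-g28-TRANSFER-PRINCIPLE.md` §2, §4.6.  With `delV v F = {S ∈ F : v ∉ S}` and `linkV v F = {S ⊆ V−v : S+v ∈ F}` every generating function splits as
`GF(F) = GF(delV) + s_v·GF(linkV)` (`gf_eq_delV_add_linkV`, from `…VertexAtoms.gf_powerset_filter_split`), so `R_D(𝒳,𝒵) = Σ_{j ≤ 3} s_v^j·P_j` with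
`v`-free `P_j` (`Rlump_eq_vertexExpansion`; `P_j = RlumpVx D F G v j`).  The four coefficient slices at a profile `m` with `m_v = 0` are the coefficients of
the `P_j` (`coeff_Rlump_add_single`), and the ring identity `P₁ − P₀ − P₂ + P₃ = (GF(D⁰) − GF(D¹))·(GF(X¹) − GF(X⁰))·(GF(Z¹) − GF(Z⁰))`
(`RlumpVx_alt_sum`) gives **`coeff_C1_sub_C2_eq`**; for a down-set `D` (`D¹ ⊆ D⁰`) and up-sets (`X⁰ ⊆ X¹`, `Z⁰ ⊆ Z¹`) the right side is `≥ 0`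
(`coeff_C1_sub_C2_nonneg`), so C2 implies C1 and **`coeff_Rlump_nonneg_of_C2`**: the single conjecture C2 of memo g27 §4.2 (`G ∈ ℕ[s]`, 0 failures
k ≤ 10 for thresholds) implies `R_D(𝒳,𝒵) ∈ ℕ[s]` (via `…LumpedForms.coeff_Rlump_nonneg_of_C1_C2`).  Nothing is asserted about the crux.
-/

noncomputable section

open scoped Classical

namespace Summit.CriticalPhenomena.PercolationContinuityZ3.Theorems.SahiCTCForms

open Finset MvPolynomial SahiCTCGenFun

variable {α : Type*} [DecidableEq α] [Fintype α]

/-! ### Deletion and link of a family at a vertex -/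

/-- The members of `F` avoiding `v`. [this work] -/
def delV (v : α) (F : Finset (Finset α)) : Finset (Finset α) := F.filter fun S => v ∉ S

/-- The link of `F` at `v`: sets `S ⊆ V − v` with `S + v ∈ F`. [this work] -/
def linkV (v : α) (F : Finset (Finset α)) : Finset (Finset α) := (univ.erase v).powerset.filter fun S => insert v S ∈ F

/-- **Vertex split of a generating function**: `GF(F) = GF(delV v F) + s_v·GF(linkV v F)`. [this work] -/
theorem gf_eq_delV_add_linkV (v : α) (F : Finset (Finset α)) : gf F = gf (delV v F) + X v * gf (linkV v F) := by
  have h := gf_powerset_filter_split (V := (univ : Finset α)) (mem_univ v) (fun S => S ∈ F)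
  have h1 : (univ.powerset.filter fun S => S ∈ F) = F := by
    ext S; simp only [mem_filter, mem_powerset, subset_univ, true_and]
  have h2 : ((univ.erase v).powerset.filter fun S => S ∈ F) = delV v F := by
    ext S; simp only [delV, mem_filter, mem_powerset, subset_erase, subset_univ, true_and]; tauto
  rw [h1, h2] at h
  exact h

omit [Fintype α] in
/-- Members of `delV v F` avoid `v`. [this work] -/
theorem not_mem_of_mem_delV {v : α} {F : Finset (Finset α)} {S : Finset α} (h : S ∈ delV v F) : v ∉ S := (mem_filter.1 h).2

/-- Members of `linkV v F` avoid `v`. [this work] -/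
theorem not_mem_of_mem_linkV {v : α} {F : Finset (Finset α)} {S : Finset α} (h : S ∈ linkV v F) : v ∉ S :=
  (subset_erase.1 (mem_powerset.1 (mem_filter.1 h).1)).2

/-- For a down-set, the link is contained in the deletion. [this work] -/
theorem linkV_subset_delV_of_isLowerSet {v : α} {D : Finset (Finset α)} (hD : IsLowerSet (D : Set (Finset α))) : linkV v D ⊆ delV v D := by
  intro S hS
  exact mem_filter.2 ⟨hD (subset_insert v S) (mem_filter.1 hS).2, not_mem_of_mem_linkV hS⟩

/-- For an up-set, the deletion is contained in the link. [this work] -/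
theorem delV_subset_linkV_of_isUpperSet {v : α} {F : Finset (Finset α)} (hF : IsUpperSet (F : Set (Finset α))) : delV v F ⊆ linkV v F := by
  intro S hS
  obtain ⟨hSF, hvS⟩ := mem_filter.1 hS
  refine mem_filter.2 ⟨mem_powerset.2 (subset_erase.2 ⟨subset_univ _, hvS⟩), hF (subset_insert v S) hSF⟩

omit [Fintype α] in
/-- `GF(G) − GF(F) ∈ ℕ[s]` for `F ⊆ G`. [this work] -/
theorem coeff_gf_sub_gf_nonneg {F G : Finset (Finset α)} (h : F ⊆ G) (m : α →₀ ℕ) : 0 ≤ (gf G - gf F).coeff m := by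
  have : gf G = gf F + gf (G \ F) := by rw [← gf_union disjoint_sdiff, union_sdiff_of_subset h]
  rw [this, add_sub_cancel_left]; exact coeff_gf_nonneg _ m

/-! ### `v`-free polynomials and coefficient extraction -/

omit [Fintype α] in
/-- The generating function of a family of sets avoiding `v` is `v`-free (no monomial containing `s_v`). [this work] -/
theorem vfree_gf {v : α} {F : Finset (Finset α)} (h : ∀ S ∈ F, v ∉ S) : ∀ m : α →₀ ℕ, m v ≠ 0 → (gf F).coeff m = 0 := by
  intro m hm
  rw [coeff_gf, Nat.cast_eq_zero, card_eq_zero, filter_eq_empty_iff]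
  intro S hS hind
  have := congrArg (fun f => f v) hind
  simp only [ind_apply, if_neg (h S hS)] at this
  exact hm this.symm

omit [DecidableEq α] [Fintype α] in
/-- Sums of `v`-free polynomials are `v`-free. [this work] -/
theorem vfree_add {v : α} {P Q : MvPolynomial α ℤ} (hP : ∀ m : α →₀ ℕ, m v ≠ 0 → P.coeff m = 0)
    (hQ : ∀ m : α →₀ ℕ, m v ≠ 0 → Q.coeff m = 0) : ∀ m : α →₀ ℕ, m v ≠ 0 → (P + Q).coeff m = 0 :=
  fun m hm => by rw [coeff_add, hP m hm, hQ m hm, add_zero]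

omit [DecidableEq α] [Fintype α] in
/-- Differences of `v`-free polynomials are `v`-free. [this work] -/
theorem vfree_sub {v : α} {P Q : MvPolynomial α ℤ} (hP : ∀ m : α →₀ ℕ, m v ≠ 0 → P.coeff m = 0)
    (hQ : ∀ m : α →₀ ℕ, m v ≠ 0 → Q.coeff m = 0) : ∀ m : α →₀ ℕ, m v ≠ 0 → (P - Q).coeff m = 0 :=
  fun m hm => by rw [coeff_sub, hP m hm, hQ m hm, sub_zero]

omit [DecidableEq α] [Fintype α] in
/-- Products of `v`-free polynomials are `v`-free. [this work] -/
theorem vfree_mul {v : α} {P Q : MvPolynomial α ℤ} (hP : ∀ m : α →₀ ℕ, m v ≠ 0 → P.coeff m = 0)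
    (hQ : ∀ m : α →₀ ℕ, m v ≠ 0 → Q.coeff m = 0) : ∀ m : α →₀ ℕ, m v ≠ 0 → (P * Q).coeff m = 0 := by
  intro m hm
  rw [coeff_mul]
  refine sum_eq_zero fun x hx => ?_
  rw [Finset.mem_antidiagonal] at hx
  have hv : x.1 v + x.2 v = m v := by rw [← Finsupp.add_apply, hx]
  by_cases h1 : x.1 v = 0
  · rw [hQ x.2 (by omega), mul_zero]
  · rw [hP x.1 h1, zero_mul]

omit [DecidableEq α] [Fintype α] in
/-- **Coefficient extraction**: for `v`-free `P`, `coeff_{m + j·e_v}(s_v^i·P) = [i = j]·coeff_m P` when `m_v = 0`. [this work] -/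
theorem coeff_X_pow_mul_of_vfree {v : α} {P : MvPolynomial α ℤ} (hP : ∀ m : α →₀ ℕ, m v ≠ 0 → P.coeff m = 0) (i j : ℕ)
    {m : α →₀ ℕ} (hm : m v = 0) :
    (X v ^ i * P).coeff (m + Finsupp.single v j) = if i = j then P.coeff m else 0 := by
  rw [X_pow_eq_monomial, coeff_monomial_mul', one_mul]
  have hle : Finsupp.single v i ≤ m + Finsupp.single v j ↔ i ≤ j := by
    rw [Finsupp.single_le_iff, Finsupp.add_apply, Finsupp.single_eq_same, hm, zero_add]
  by_cases hij : i = j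
  · subst hij
    rw [if_pos (hle.2 le_rfl), if_pos rfl, add_tsub_cancel_right]
  · rw [if_neg hij]
    by_cases hle' : i ≤ j
    · rw [if_pos (hle.2 hle')]
      apply hP
      rw [Finsupp.tsub_apply, Finsupp.add_apply, Finsupp.single_eq_same, Finsupp.single_eq_same, hm]; omega
    · rw [if_neg (fun h => hle' (hle.1 h))]

/-! ### The vertex expansion of `R_D` -/

section Expansion

variable (D F G : Finset (Finset α)) (v : α)

/-- The four `v`-free coefficient polynomials `P_j` of `R_D(𝒳,𝒵) = Σ_j s_v^j P_j` (memo g27 §4.1–4.2 `R_0, R_1, R_2, R_3`, for any lumped `D`;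
`a/a'` = GF of deletion/link of `D`, `π` of `Π`, `c/c'` of `(𝒳∩𝒵)∖D`, `x/x'`, `z/z'` of `𝒳`, `𝒵`, `p/p'`, `q/q'` of `𝒳∩D`, `𝒵∩D`). [this work] -/
def RlumpVx : ℕ → MvPolynomial α ℤ
  | 0 => gf (delV v D) * (gf (delV v (univ.powerset : Finset (Finset α))) * gf (delV v ((F ∩ G).filter fun S => S ∉ D))
        - gf (delV v F) * gf (delV v G))
      + gf (delV v (univ.powerset : Finset (Finset α))) * (gf (delV v (F.filter fun S => S ∈ D)) * gf (delV v (G.filter fun S => S ∈ D)))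
  | 1 => gf (delV v D) * (gf (delV v (univ.powerset : Finset (Finset α)))
          * (gf (delV v ((F ∩ G).filter fun S => S ∉ D)) + gf (linkV v ((F ∩ G).filter fun S => S ∉ D)))
        - gf (delV v F) * gf (linkV v G) - gf (linkV v F) * gf (delV v G))
      + gf (linkV v D) * (gf (delV v (univ.powerset : Finset (Finset α))) * gf (delV v ((F ∩ G).filter fun S => S ∉ D))
        - gf (delV v F) * gf (delV v G))
      + gf (delV v (univ.powerset : Finset (Finset α))) * (gf (delV v (F.filter fun S => S ∈ D)) * gf (linkV v (G.filter fun S => S ∈ D))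
        + gf (linkV v (F.filter fun S => S ∈ D)) * gf (delV v (G.filter fun S => S ∈ D))
        + gf (delV v (F.filter fun S => S ∈ D)) * gf (delV v (G.filter fun S => S ∈ D)))
  | 2 => gf (delV v D) * (gf (delV v (univ.powerset : Finset (Finset α))) * gf (linkV v ((F ∩ G).filter fun S => S ∉ D))
        - gf (linkV v F) * gf (linkV v G))
      + gf (linkV v D) * (gf (delV v (univ.powerset : Finset (Finset α)))
          * (gf (delV v ((F ∩ G).filter fun S => S ∉ D)) + gf (linkV v ((F ∩ G).filter fun S => S ∉ D)))
        - gf (delV v F) * gf (linkV v G) - gf (linkV v F) * gf (delV v G))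
      + gf (delV v (univ.powerset : Finset (Finset α))) * (gf (linkV v (F.filter fun S => S ∈ D)) * gf (linkV v (G.filter fun S => S ∈ D))
        + gf (delV v (F.filter fun S => S ∈ D)) * gf (linkV v (G.filter fun S => S ∈ D))
        + gf (linkV v (F.filter fun S => S ∈ D)) * gf (delV v (G.filter fun S => S ∈ D)))
  | 3 => gf (linkV v D) * (gf (delV v (univ.powerset : Finset (Finset α))) * gf (linkV v ((F ∩ G).filter fun S => S ∉ D))
        - gf (linkV v F) * gf (linkV v G))
      + gf (delV v (univ.powerset : Finset (Finset α))) * (gf (linkV v (F.filter fun S => S ∈ D)) * gf (linkV v (G.filter fun S => S ∈ D)))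
  | _ + 4 => 0

/-- The link of the whole power set at `v` is the power set of `V − v`, i.e. its deletion. [this work] -/
theorem linkV_powerset_eq : linkV v (univ.powerset : Finset (Finset α)) = delV v univ.powerset := by
  ext S
  simp only [linkV, delV, mem_filter, mem_powerset, subset_univ, true_and, and_true, subset_erase]

/-- **`R_D(𝒳,𝒵) = P₀ + s_v·P₁ + s_v²·P₂ + s_v³·P₃`.** [this work] -/
theorem Rlump_eq_vertexExpansion :
    Rlump D F G = RlumpVx D F G v 0 + X v * RlumpVx D F G v 1 + X v ^ 2 * RlumpVx D F G v 2 + X v ^ 3 * RlumpVx D F G v 3 := by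
  simp only [RlumpVx]
  unfold Rlump PiP
  rw [gf_eq_delV_add_linkV v D, gf_eq_delV_add_linkV v (univ.powerset : Finset (Finset α)), linkV_powerset_eq,
    gf_eq_delV_add_linkV v ((F ∩ G).filter fun S => S ∉ D), gf_eq_delV_add_linkV v F, gf_eq_delV_add_linkV v G,
    gf_eq_delV_add_linkV v (F.filter fun S => S ∈ D), gf_eq_delV_add_linkV v (G.filter fun S => S ∈ D)]
  ring

/-- The `P_j` are `v`-free. [this work] -/
theorem vfree_RlumpVx (j : ℕ) : ∀ m : α →₀ ℕ, m v ≠ 0 → (RlumpVx D F G v j).coeff m = 0 := by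
  have hd : ∀ K : Finset (Finset α), ∀ m : α →₀ ℕ, m v ≠ 0 → (gf (delV v K)).coeff m = 0 :=
    fun K => vfree_gf fun S hS => not_mem_of_mem_delV hS
  have hl : ∀ K : Finset (Finset α), ∀ m : α →₀ ℕ, m v ≠ 0 → (gf (linkV v K)).coeff m = 0 :=
    fun K => vfree_gf fun S hS => not_mem_of_mem_linkV hS
  rcases j with _ | _ | _ | _ | j
  · exact vfree_add (vfree_mul (hd _) (vfree_sub (vfree_mul (hd _) (hd _)) (vfree_mul (hd _) (hd _))))
      (vfree_mul (hd _) (vfree_mul (hd _) (hd _)))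
  · exact vfree_add (vfree_add (vfree_mul (hd _) (vfree_sub (vfree_sub (vfree_mul (hd _) (vfree_add (hd _) (hl _))) (vfree_mul (hd _) (hl _)))
      (vfree_mul (hl _) (hd _)))) (vfree_mul (hl _) (vfree_sub (vfree_mul (hd _) (hd _)) (vfree_mul (hd _) (hd _)))))
      (vfree_mul (hd _) (vfree_add (vfree_add (vfree_mul (hd _) (hl _)) (vfree_mul (hl _) (hd _))) (vfree_mul (hd _) (hd _))))
  · exact vfree_add (vfree_add (vfree_mul (hd _) (vfree_sub (vfree_mul (hd _) (hl _)) (vfree_mul (hl _) (hl _))))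
      (vfree_mul (hl _) (vfree_sub (vfree_sub (vfree_mul (hd _) (vfree_add (hd _) (hl _))) (vfree_mul (hd _) (hl _))) (vfree_mul (hl _) (hd _)))))
      (vfree_mul (hd _) (vfree_add (vfree_add (vfree_mul (hl _) (hl _)) (vfree_mul (hd _) (hl _))) (vfree_mul (hl _) (hd _))))
  · exact vfree_add (vfree_mul (hl _) (vfree_sub (vfree_mul (hd _) (hl _)) (vfree_mul (hl _) (hl _)))) (vfree_mul (hd _) (vfree_mul (hl _) (hl _)))
  · intro m _; simp [RlumpVx]

/-- **The alternating sum of the slices**: `P₁ − P₀ − P₂ + P₃ = (GF(D⁰) − GF(D¹))·(GF(X¹) − GF(X⁰))·(GF(Z¹) − GF(Z⁰))`. [this work] -/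
theorem RlumpVx_alt_sum :
    RlumpVx D F G v 1 - RlumpVx D F G v 0 - RlumpVx D F G v 2 + RlumpVx D F G v 3 =
      (gf (delV v D) - gf (linkV v D)) * (gf (linkV v F) - gf (delV v F)) * (gf (linkV v G) - gf (delV v G)) := by
  simp only [RlumpVx]
  ring

/-- **The coefficient slices of `R_D` at `v`**: for `m_v = 0`, `coeff_{m + j·e_v} R_D = coeff_m P_j` (`j ≤ 3`). [this work] -/
theorem coeff_Rlump_add_single {m : α →₀ ℕ} (hm : m v = 0) {j : ℕ} (hj : j ≤ 3) :
    (Rlump D F G).coeff (m + Finsupp.single v j) = (RlumpVx D F G v j).coeff m := by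
  rw [Rlump_eq_vertexExpansion D F G v, coeff_add, coeff_add, coeff_add]
  rw [show RlumpVx D F G v 0 = X v ^ 0 * RlumpVx D F G v 0 by rw [pow_zero, one_mul],
    show X v * RlumpVx D F G v 1 = X v ^ 1 * RlumpVx D F G v 1 by rw [pow_one]]
  rw [coeff_X_pow_mul_of_vfree (vfree_RlumpVx D F G v 0) 0 j hm, coeff_X_pow_mul_of_vfree (vfree_RlumpVx D F G v 1) 1 j hm,
    coeff_X_pow_mul_of_vfree (vfree_RlumpVx D F G v 2) 2 j hm, coeff_X_pow_mul_of_vfree (vfree_RlumpVx D F G v 3) 3 j hm]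
  rcases j with _ | _ | _ | _ | j
  · simp
  · simp
  · simp
  · simp
  · omega

end Expansion

/-! ### C1 − C2 and C2 ⇒ nonnegativity -/

/-- **C1 − C2 identity** (memo g27 §4.3, any lumped `D`): for `m_v = 0`,
`[c(m+e_v) − c(m)] − [c(m+2e_v) − c(m+3e_v)] = coeff_m ((GF(D⁰)−GF(D¹))·(GF(X¹)−GF(X⁰))·(GF(Z¹)−GF(Z⁰)))`. [this work] -/
theorem coeff_C1_sub_C2_eq (D F G : Finset (Finset α)) (v : α) {m : α →₀ ℕ} (hm : m v = 0) :
    ((Rlump D F G).coeff (m + Finsupp.single v 1) - (Rlump D F G).coeff m)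
      - ((Rlump D F G).coeff (m + Finsupp.single v 2) - (Rlump D F G).coeff (m + Finsupp.single v 3)) =
      ((gf (delV v D) - gf (linkV v D)) * (gf (linkV v F) - gf (delV v F)) * (gf (linkV v G) - gf (delV v G))).coeff m := by
  have h0 : (Rlump D F G).coeff m = (RlumpVx D F G v 0).coeff m := by
    have := coeff_Rlump_add_single D F G v hm (j := 0) (by omega)
    rwa [Finsupp.single_zero, add_zero] at this
  rw [h0, coeff_Rlump_add_single D F G v hm (by omega), coeff_Rlump_add_single D F G v hm (by omega),
    coeff_Rlump_add_single D F G v hm (by omega), ← RlumpVx_alt_sum, coeff_add, coeff_sub, coeff_sub]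
  ring

/-- For a down-set `D` and up-sets `𝒳, 𝒵` the C1 − C2 difference is `≥ 0`. [this work] -/
theorem coeff_C1_sub_C2_nonneg {D F G : Finset (Finset α)} (hD : IsLowerSet (D : Set (Finset α)))
    (hF : IsUpperSet (F : Set (Finset α))) (hG : IsUpperSet (G : Set (Finset α))) (v : α) {m : α →₀ ℕ} (hm : m v = 0) :
    (Rlump D F G).coeff (m + Finsupp.single v 2) - (Rlump D F G).coeff (m + Finsupp.single v 3) ≤
      (Rlump D F G).coeff (m + Finsupp.single v 1) - (Rlump D F G).coeff m := by
  rw [← sub_nonneg, coeff_C1_sub_C2_eq D F G v hm]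
  exact coeff_mul_nonneg (coeff_mul_nonneg (coeff_gf_sub_gf_nonneg (linkV_subset_delV_of_isLowerSet hD))
    (coeff_gf_sub_gf_nonneg (delV_subset_linkV_of_isUpperSet hF))) (coeff_gf_sub_gf_nonneg (delV_subset_linkV_of_isUpperSet hG)) m

/-- **C2 ALONE ⇒ `R_D ∈ ℕ[s]`** for a down-set `D` and up-sets `𝒳, 𝒵` (memo g27 §4.3: C2 ⇒ C1, then the reduction of `…SahiCTCLumpedForms`). [this work] -/
theorem coeff_Rlump_nonneg_of_C2 {D F G : Finset (Finset α)} (hD : IsLowerSet (D : Set (Finset α)))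
    (hF : IsUpperSet (F : Set (Finset α))) (hG : IsUpperSet (G : Set (Finset α)))
    (hC2 : ∀ (m : α →₀ ℕ) (v : α), m v = 2 → (Rlump D F G).coeff (m + Finsupp.single v 1) ≤ (Rlump D F G).coeff m) (m : α →₀ ℕ) :
    0 ≤ (Rlump D F G).coeff m := by
  refine coeff_Rlump_nonneg_of_C1_C2 D F G (fun m v hv => ?_) hC2 m
  -- C1 at `m` (`m_v = 1`): write `m = m₀ + e_v` with `m₀ v = 0`
  set m₀ := m - Finsupp.single v 1 with hm₀
  have hm₀v : m₀ v = 0 := by rw [hm₀, Finsupp.tsub_apply, Finsupp.single_eq_same, hv]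
  have hm_eq : m = m₀ + Finsupp.single v 1 := by
    rw [hm₀, tsub_add_cancel_of_le]
    rw [Finsupp.single_le_iff, hv]
  have h2 : (Rlump D F G).coeff (m₀ + Finsupp.single v 2 + Finsupp.single v 1) ≤ (Rlump D F G).coeff (m₀ + Finsupp.single v 2) :=
    hC2 _ v (by rw [Finsupp.add_apply, Finsupp.single_eq_same, hm₀v])
  rw [add_assoc, ← Finsupp.single_add] at h2
  have h3 := coeff_C1_sub_C2_nonneg hD hF hG v hm₀v
  rw [hm_eq]
  linarith

end Summit.CriticalPhenomena.PercolationContinuityZ3.Theorems.SahiCTCForms
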